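import Literature.AnabelianGeometry.EtaleTheta.Discharge.Sec5Thm57JunctionJ2OfRigidData
import Literature.AnabelianGeometry.EtaleTheta.Discharge.Sec5LDeltaCoveredOfPins

/-!
# [EtTh] §5, Theorem 5.7 (C)-junction at the genuine level-`N` data: the `γ_Δ` of `hK4`/`hC5` IS the étale transport `φΛ` — PROOF-ONLY

Mochizuki, *The étale theta function and its Frobenioid-theoretic manifestations*, Publ. RIMS **45** (2009)
[cite: MochizukiEtTh2009, Thm 5.7 proof p.330 (PDF p.104); Thm 5.6 p.328–329 (PDF pp.102–103); Cor 2.18 (i) p.60].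
Seat abc-iut-L2-t9 (gen 5); third sequel of my R479 junction file `Sec5Thm57JunctionHK4OfK4.lean` (p458989 / v2 p462939), over
`Sec5Thm57JunctionJ2OfRigidData.lean` (p462571) and `Sec5LDeltaCoveredOfPins.lean` (p460877).  PROOF-ONLY (0 definitions; nothing restated).

THE POINT.  In the Kummer comparison of Thm. 5.7 (abc-iut-L2-d4's `kummerComparison_of_thetaSectionCompat`, p453757; per-level clause
`exists_torsionRoot_isFixed_of_thetaSectionCompat`, p458762) the K4 side (`hK4`) and the R-C5 side (`hC5`, `hκ`) must speak about ONE self-map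
`γ_Δ` of `μ_N`.  Two candidates are on the table at abc-iut-L2-t4's genuine level-`N` data `ofConnectedTemperoidData h (RD.levelStub ιX) …`:
abc-iut-w5-d034's conjugation `γ_Δ⁰ := m ∘ ρ_{B_N} ∘ ((l·Δ_Θ) ⊗ ℤ/N)(β) ∘ aΨ_{B_N} ∘ ρ_{B_N}⁻¹ ∘ m⁻¹` (for which `hK4` is (K4β) alone,
`psiAut_symm_eq_conj`) and the ÉTALE transport `φΛ : μ_N ⥲ μ_N` — the level-`N` descent of the [SemiAnbd] Prop. 3.2 datum `φ` of `Ψ^bs`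
(binders `hq`/`hι` of abc-iut-w5-d034's p450400 / abc-iut-w5-d020's `deltaTransport`), the map about which Cor. 2.8 (i) speaks.
* `phiLambda_eq_conj_levelStub_of_pins` — **they COINCIDE**: `φΛ = γ_Δ⁰` as maps `μ_N → μ_N`, from the two pins `hPpre`/`hPproj_pin` on `P`
  at `B_N^bs`, `hH` («`ιX⁻¹(Stab x) ≤ Π^tp_Ÿ`», a theorem for `A_⊙^bs := Ÿ`), the Prop. 5.2 (iii) pin `ThetaSectionCompat` (F-0521),
  `η ∈ RD.thetaCocycles`, Prop. 5.5 at `B_N` (`IsKummerDetermined P ρ hB`), T56-L09c `DeltaTransportCompat Ψ β aΨ θ′ P`, the shadow law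
  `θ′(ρ k) = ρ(ιX⁻¹ φ ιX k)`, `hq`/`hι`, and Cor. 2.18 (i) (`RD.Cor218_i`, F-0620) — by `gammaDelta_eq_conj_of_eta` (coverage:
  `lDeltaCovered_levelStub_of_pins`; (J2η) for `φΛ`: `gammaDelta_eta_levelStub_of_pin`);
* `psiAut_symm_eq_phiLambda_levelStub_of_pins` — hence **`hK4` of p453757 VERBATIM at the level-`N` data for `γ_Δ := φΛ`**, given (K4β)
  (conjunct 3 of p450400) in addition.
So R-C5's targets `hC5`/`hκ` (abc-iut-w6-d049, R535/R544) are about `φΛ`, equivalently about `γ_Δ⁰` — no choice is left open.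
HONEST FRAMING: kernel-checked implications between typed statements; none of the pins / binders is asserted to be inhabited at an actual curve
(GAP G-w4d042g3-1, my p456572); [EtTh] is refereed; typed ≠ discharged; no side taken on [IUTchIII] Cor. 3.12.
-/

noncomputable section

namespace Literature.AnabelianGeometry.EtaleTheta

open CategoryTheory Opposite FrobenioidCyclotomicRigidity Literature.AlgebraicGeometry.Frobenioids
  Literature.AnabelianGeometry.SemiGraphs Literature.AnabelianGeometry.SemiGraphs.GaloisObjects
open Literature.AlgebraicGeometry.Frobenioids.QuasiTemperoid (stabilizerSubgroup)

universe u₀ v₀ w'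

namespace ThetaFrobenioid

section LevelN

variable {K : Type u₀} [Field K] {X : SemiGraphs.TemperedArithmeticGroup.{u₀} K} {D₀ : Type u₀} [Category.{v₀} D₀]
  {V : FrdIMonoidStub.{max u₀ w'}} {T₀ : RealifiedDivisorMonoids (D₀ := D₀) V}
  {VD : FrdICatStub.{u₀ + 1, u₀, max u₀ w'} (ConnectedPart (BTemp X.Pi))}
  {tf : TemperedFrobenioid T₀ (ConnectedPart (BTemp X.Pi)) VD} {hZ : tf.monoidType = MonoidType.Z}
  {hP : ∀ A : (ConnectedPart (BTemp X.Pi))ᵒᵖ, IsPerfect (tf.Φ.carrier A)}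
  {NH : Subgroup (Field.absoluteGaloisGroup K) → tf.category → ℕ+ → Prop} {A₀ : tf.category}
  {hA₀ : PreFrobenioid.IsFrobeniusTrivial tf.toElem A₀} {hA₀' : SemiGraphs.IsGaloisObj A₀.base.obj}
  {lv N : ℕ+} {l' : ℕ} {RD : RigidData.{max u₀ w'} N l'}
  {pullFrac : ∀ {A A' : (BiKummerSetting.mkOfConnectedTemperoid X tf hZ hP NH A₀ hA₀ hA₀').C} (_ : A' ⟶ A),
    (BiKummerSetting.mkOfConnectedTemperoid X tf hZ hP NH A₀ hA₀ hA₀').biratUnits A →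
      (BiKummerSetting.mkOfConnectedTemperoid X tf hZ hP NH A₀ hA₀ hA₀').biratUnits A'}
  {θ : (BiKummerSetting.mkOfConnectedTemperoid X tf hZ hP NH A₀ hA₀ hA₀').biratUnits
    (BiKummerSetting.mkOfConnectedTemperoid X tf hZ hP NH A₀ hA₀ hA₀').Aodot}
  {Bl : (BiKummerSetting.mkOfConnectedTemperoid X tf hZ hP NH A₀ hA₀ hA₀').C}
  {Pl : (BiKummerSetting.mkOfConnectedTemperoid X tf hZ hP NH A₀ hA₀ hA₀').FractionPair θ Bl}
  {Rl : (BiKummerSetting.mkOfConnectedTemperoid X tf hZ hP NH A₀ hA₀ hA₀').NthRoot θ Pl lv pullFrac}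
  (h : ModelFrobenioid.Hypotheses tf.divisorMonoid tf.ratFnFunctor)
  (odd_l : Odd (lv : ℕ))
  (R : (BiKummerSetting.mkOfConnectedTemperoid X tf hZ hP NH A₀ hA₀ hA₀').NthRoot Rl.root Rl.pair N pullFrac)
  (ιX : RD.PiX ≃ₜ* X.Pi) (K' : Type (max u₀ w')) [Field K'] (constEmb : K'ˣ →* tf.biratUnitsModel R.BN)
  (constEmb_injective : Function.Injective constEmb)
  (hinvc : ∀ g : Aut R.AN.base,
    pull tf.divisorMonoid g.hom (ModelFrobenioid.div R.pair.num) = ModelFrobenioid.div R.pair.num)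
  (hinvp : ∀ y : RD.PiX, y ∈ RD.PiYdd →
    pull tf.divisorMonoid ((BiKummerSetting.mkOfConnectedTemperoid X tf hZ hP NH A₀ hA₀ hA₀').galoisSurj R.AN.base
      R.αData.isGalois (ιX y)).hom (ModelFrobenioid.div R.pair.den) = ModelFrobenioid.div R.pair.den)
  [RD.iotaN.range.Normal]

/-- **`φΛ = γ_Δ⁰` at the genuine level-`N` data**: the étale transport `φΛ` of `μ_N` (level-`N` descent of the [SemiAnbd] Prop. 3.2 datum `φ`)
EQUALS abc-iut-w5-d034's conjugation `m ∘ ρ_{B_N} ∘ ((l·Δ_Θ) ⊗ ℤ/N)(β) ∘ aΨ_{B_N} ∘ ρ_{B_N}⁻¹ ∘ m⁻¹` — by `gammaDelta_eq_conj_of_eta` (p462939) with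
coverage `lDeltaCovered_levelStub_of_pins` (p460877) and (J2η) for `φΛ` `gammaDelta_eta_levelStub_of_pin` (p462571).
[cite: MochizukiEtTh2009, Thm 5.7 proof p.330 (PDF p.104); Thm 5.6 proof p.329 (PDF p.103); Cor 2.18 (i) p.60] -/
theorem phiLambda_eq_conj_levelStub_of_pins
    (P : ThetaSubquotientProj (ofConnectedTemperoidData h (RD.levelStub ιX) odd_l R ιX K' constEmb constEmb_injective hinvc hinvp))
    (hPpre : P.pre R.BN.base =
      (ThetaSubquotient.autPre (RD.qN ιX) RD.iotaN R.BN.base.obj).comap (Functor.mapAut R.BN.base (connectedObjects (BTemp X.Pi)).ι))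
    (hPproj_pin : ∀ (σ : P.pre R.BN.base) (τ : ThetaSubquotient.autPre (RD.qN ιX) RD.iotaN R.BN.base.obj),
      Functor.mapAut R.BN.base (connectedObjects (BTemp X.Pi)).ι (σ : Aut R.BN.base) = (τ : Aut R.BN.base.obj) →
        (P.proj R.BN.base σ : ThetaSubquotient.LDelta (RD.qN ιX) RD.iotaN R.BN.base.obj) =
          ThetaSubquotient.autProj (RD.qN ιX) RD.iotaN R.BN.base.obj τ)
    (hH : (stabilizerSubgroup R.BN.base.obj ((BiKummerSetting.NthRoot.baseIso _ R).hom.hom.hom.hom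
        (galoisBase X.isTempered R.AN.base.obj R.αData.isGalois))).comap ιX.toMonoidHom ≤ RD.PiYdd)
    (HF : (ofConnectedTemperoidData h (RD.levelStub ιX) odd_l R ιX K' constEmb constEmb_injective hinvc hinvp).Facts)
    (m : (ofConnectedTemperoidData h (RD.levelStub ιX) odd_l R ιX K' constEmb constEmb_injective hinvc hinvp).muTorsion
      (ofConnectedTemperoidData h (RD.levelStub ιX) odd_l R ιX K' constEmb constEmb_injective hinvc hinvp).BN
      (ofConnectedTemperoidData h (RD.levelStub ιX) odd_l R ιX K' constEmb constEmb_injective hinvc hinvp).N ≃* RD.mu)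
    (hι : (ofConnectedTemperoidData h (RD.levelStub ιX) odd_l R ιX K' constEmb constEmb_injective hinvc hinvp).IdentifiesPiYdd
      RD.toThetaEnvData (MulEquiv.refl _))
    {η : RD.PiYdd → RD.mu} (hη : η ∈ RD.thetaCocycles)
    (hpin : (ofConnectedTemperoidData h (RD.levelStub ιX) odd_l R ιX K' constEmb constEmb_injective hinvc hinvp).ThetaSectionCompat
      HF RD.toThetaEnvData (MulEquiv.refl _) m hι η)
    {ρ : RigidityFamily (ofConnectedTemperoidData h (RD.levelStub ιX) odd_l R ιX K' constEmb constEmb_injective hinvc hinvp)}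
    {hB : (ofConnectedTemperoidData h (RD.levelStub ιX) odd_l R ιX K' constEmb constEmb_injective hinvc hinvp).IsThetaSaturated
      (ofConnectedTemperoidData h (RD.levelStub ιX) odd_l R ιX K' constEmb constEmb_injective hinvc hinvp).BN}
    (hKD : IsKummerDetermined (ofConnectedTemperoidData h (RD.levelStub ιX) odd_l R ιX K' constEmb constEmb_injective hinvc hinvp) P ρ hB)
    (Ψ : (BiKummerSetting.mkOfConnectedTemperoid X tf hZ hP NH A₀ hA₀ hA₀').C ≌
      (BiKummerSetting.mkOfConnectedTemperoid X tf hZ hP NH A₀ hA₀ hA₀').C)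
    (β : Ψ.functor.obj (ofConnectedTemperoidData h (RD.levelStub ιX) odd_l R ιX K' constEmb constEmb_injective hinvc hinvp).BN ≅
      (ofConnectedTemperoidData h (RD.levelStub ιX) odd_l R ιX K' constEmb constEmb_injective hinvc hinvp).BN)
    (aΨ : ∀ S, (ofConnectedTemperoidData h (RD.levelStub ιX) odd_l R ιX K' constEmb constEmb_injective hinvc hinvp).lDeltaModN S ≃*
      (ofConnectedTemperoidData h (RD.levelStub ιX) odd_l R ιX K' constEmb constEmb_injective hinvc hinvp).lDeltaModN (Ψ.functor.obj S))
    (θ' : Aut R.BN.base ≃* Aut R.BN.base)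
    (hΔ : Thm56Sub.DeltaTransportCompat (ofConnectedTemperoidData h (RD.levelStub ιX) odd_l R ιX K' constEmb constEmb_injective hinvc hinvp)
      Ψ β aΨ θ' P)
    (φ : X.Pi ≃ₜ* X.Pi) (φQ : RD.LevelQuot ≃* RD.LevelQuot) (φΛ : RD.mu ≃* RD.mu)
    (hq : ∀ g : X.Pi, RD.qN ιX (φ g) = φQ (RD.qN ιX g)) (hιN : ∀ a : RD.mu, RD.iotaN (φΛ a) = φQ (RD.iotaN a))
    (h218i : RD.Cor218_i)
    (hshadow : ∀ k : RD.PiYdd, θ' (rhoOfBiKummerData R ιX k) = rhoOfBiKummerData R ιX (ιX.symm (φ (ιX k)))) :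
    (φΛ : RD.mu → RD.mu) = fun x => m (ρ (ofConnectedTemperoidData h (RD.levelStub ιX) odd_l R ιX K' constEmb constEmb_injective hinvc hinvp).BN hB ((ofConnectedTemperoidData h (RD.levelStub ιX) odd_l R ιX K' constEmb constEmb_injective hinvc hinvp).lDeltaModNMap β.hom (aΨ (ofConnectedTemperoidData h (RD.levelStub ιX) odd_l R ιX K' constEmb constEmb_injective hinvc hinvp).BN ((ρ (ofConnectedTemperoidData h (RD.levelStub ιX) odd_l R ιX K' constEmb constEmb_injective hinvc hinvp).BN hB).symm (m.symm x))))) := by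
  -- elaborate the level-`N` pieces one at a time (each with a closed type), then compose generically
  have hcov := lDeltaCovered_levelStub_of_pins.{u₀, v₀, w'} h odd_l R ιX K' constEmb constEmb_injective hinvc hinvp P hPpre hPproj_pin
  have hlift := hlift_levelStub_of_pin.{u₀, v₀, w'} h odd_l R ιX K' constEmb constEmb_injective hinvc hinvp P hPpre hH
  have hγ := RD.symm_apply_apply_mem_PiYdd_of_cor218i ιX h218i φ
  have hγL := RD.thetaMod_transport_of_cor218i ιX h218i φ φQ φΛ hq hιN
  have hγΔ := gammaDelta_eta_of_lift HF RD (MulEquiv.refl _) m hι hη hpin hlift θ' (fun x => ιX.symm (φ (ιX x))) hγ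
    hshadow φΛ hγL
  exact gammaDelta_eq_conj_of_eta HF RD.toThetaEnvData (MulEquiv.refl _) m hι hpin hKD hcov Ψ β aΨ θ' hΔ
    (fun x => ιX.symm (φ (ιX x))) hγ hshadow φΛ hγΔ

/-- **`hK4` of p453757 VERBATIM at the genuine level-`N` data for `γ_Δ := φΛ`**: `Ψ^Aut_β(m⁻¹ x) = m⁻¹(φΛ x)` for all `x ∈ μ_N`, given in
addition (K4β) (conjunct 3 of abc-iut-w5-d034's `exists_rigidity_kummerComparisonInputs_levelN`, p450400).
[cite: MochizukiEtTh2009, Thm 5.7 proof p.330 (PDF p.104); Thm 5.6 p.328 (PDF p.102)] -/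
theorem psiAut_symm_eq_phiLambda_levelStub_of_pins
    (P : ThetaSubquotientProj (ofConnectedTemperoidData h (RD.levelStub ιX) odd_l R ιX K' constEmb constEmb_injective hinvc hinvp))
    (hPpre : P.pre R.BN.base =
      (ThetaSubquotient.autPre (RD.qN ιX) RD.iotaN R.BN.base.obj).comap (Functor.mapAut R.BN.base (connectedObjects (BTemp X.Pi)).ι))
    (hPproj_pin : ∀ (σ : P.pre R.BN.base) (τ : ThetaSubquotient.autPre (RD.qN ιX) RD.iotaN R.BN.base.obj),
      Functor.mapAut R.BN.base (connectedObjects (BTemp X.Pi)).ι (σ : Aut R.BN.base) = (τ : Aut R.BN.base.obj) →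
        (P.proj R.BN.base σ : ThetaSubquotient.LDelta (RD.qN ιX) RD.iotaN R.BN.base.obj) =
          ThetaSubquotient.autProj (RD.qN ιX) RD.iotaN R.BN.base.obj τ)
    (hH : (stabilizerSubgroup R.BN.base.obj ((BiKummerSetting.NthRoot.baseIso _ R).hom.hom.hom.hom
        (galoisBase X.isTempered R.AN.base.obj R.αData.isGalois))).comap ιX.toMonoidHom ≤ RD.PiYdd)
    (HF : (ofConnectedTemperoidData h (RD.levelStub ιX) odd_l R ιX K' constEmb constEmb_injective hinvc hinvp).Facts)
    (m : (ofConnectedTemperoidData h (RD.levelStub ιX) odd_l R ιX K' constEmb constEmb_injective hinvc hinvp).muTorsion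
      (ofConnectedTemperoidData h (RD.levelStub ιX) odd_l R ιX K' constEmb constEmb_injective hinvc hinvp).BN
      (ofConnectedTemperoidData h (RD.levelStub ιX) odd_l R ιX K' constEmb constEmb_injective hinvc hinvp).N ≃* RD.mu)
    (hι : (ofConnectedTemperoidData h (RD.levelStub ιX) odd_l R ιX K' constEmb constEmb_injective hinvc hinvp).IdentifiesPiYdd
      RD.toThetaEnvData (MulEquiv.refl _))
    {η : RD.PiYdd → RD.mu} (hη : η ∈ RD.thetaCocycles)
    (hpin : (ofConnectedTemperoidData h (RD.levelStub ιX) odd_l R ιX K' constEmb constEmb_injective hinvc hinvp).ThetaSectionCompat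
      HF RD.toThetaEnvData (MulEquiv.refl _) m hι η)
    {ρ : RigidityFamily (ofConnectedTemperoidData h (RD.levelStub ιX) odd_l R ιX K' constEmb constEmb_injective hinvc hinvp)}
    {hB : (ofConnectedTemperoidData h (RD.levelStub ιX) odd_l R ιX K' constEmb constEmb_injective hinvc hinvp).IsThetaSaturated
      (ofConnectedTemperoidData h (RD.levelStub ιX) odd_l R ιX K' constEmb constEmb_injective hinvc hinvp).BN}
    (hKD : IsKummerDetermined (ofConnectedTemperoidData h (RD.levelStub ιX) odd_l R ιX K' constEmb constEmb_injective hinvc hinvp) P ρ hB)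
    (Ψ : (BiKummerSetting.mkOfConnectedTemperoid X tf hZ hP NH A₀ hA₀ hA₀').C ≌
      (BiKummerSetting.mkOfConnectedTemperoid X tf hZ hP NH A₀ hA₀ hA₀').C)
    (β : Ψ.functor.obj (ofConnectedTemperoidData h (RD.levelStub ιX) odd_l R ιX K' constEmb constEmb_injective hinvc hinvp).BN ≅
      (ofConnectedTemperoidData h (RD.levelStub ιX) odd_l R ιX K' constEmb constEmb_injective hinvc hinvp).BN)
    (aΨ : ∀ S, (ofConnectedTemperoidData h (RD.levelStub ιX) odd_l R ιX K' constEmb constEmb_injective hinvc hinvp).lDeltaModN S ≃*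
      (ofConnectedTemperoidData h (RD.levelStub ιX) odd_l R ιX K' constEmb constEmb_injective hinvc hinvp).lDeltaModN (Ψ.functor.obj S))
    (θ' : Aut R.BN.base ≃* Aut R.BN.base)
    (hΔ : Thm56Sub.DeltaTransportCompat (ofConnectedTemperoidData h (RD.levelStub ιX) odd_l R ιX K' constEmb constEmb_injective hinvc hinvp)
      Ψ β aΨ θ' P)
    (φ : X.Pi ≃ₜ* X.Pi) (φQ : RD.LevelQuot ≃* RD.LevelQuot) (φΛ : RD.mu ≃* RD.mu)
    (hq : ∀ g : X.Pi, RD.qN ιX (φ g) = φQ (RD.qN ιX g)) (hιN : ∀ a : RD.mu, RD.iotaN (φΛ a) = φQ (RD.iotaN a))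
    (h218i : RD.Cor218_i)
    (hshadow : ∀ k : RD.PiYdd, θ' (rhoOfBiKummerData R ιX k) = rhoOfBiKummerData R ιX (ιX.symm (φ (ιX k))))
    (hK4β : ∀ x, (ofConnectedTemperoidData h (RD.levelStub ιX) odd_l R ιX K' constEmb constEmb_injective hinvc hinvp).psiAut Ψ β
        (ρ (ofConnectedTemperoidData h (RD.levelStub ιX) odd_l R ιX K' constEmb constEmb_injective hinvc hinvp).BN hB x : Aut (ofConnectedTemperoidData h (RD.levelStub ιX) odd_l R ιX K' constEmb constEmb_injective hinvc hinvp).BN) =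
      (ρ (ofConnectedTemperoidData h (RD.levelStub ιX) odd_l R ιX K' constEmb constEmb_injective hinvc hinvp).BN hB ((ofConnectedTemperoidData h (RD.levelStub ιX) odd_l R ιX K' constEmb constEmb_injective hinvc hinvp).lDeltaModNMap β.hom
        (aΨ (ofConnectedTemperoidData h (RD.levelStub ιX) odd_l R ιX K' constEmb constEmb_injective hinvc hinvp).BN x)) : Aut (ofConnectedTemperoidData h (RD.levelStub ιX) odd_l R ιX K' constEmb constEmb_injective hinvc hinvp).BN))
    (x : RD.mu) :
    (ofConnectedTemperoidData h (RD.levelStub ιX) odd_l R ιX K' constEmb constEmb_injective hinvc hinvp).psiAut Ψ β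
        ((m.symm x : (ofConnectedTemperoidData h (RD.levelStub ιX) odd_l R ιX K' constEmb constEmb_injective hinvc hinvp).muTorsion
          (ofConnectedTemperoidData h (RD.levelStub ιX) odd_l R ιX K' constEmb constEmb_injective hinvc hinvp).BN
          (ofConnectedTemperoidData h (RD.levelStub ιX) odd_l R ιX K' constEmb constEmb_injective hinvc hinvp).N) :
          Aut (ofConnectedTemperoidData h (RD.levelStub ιX) odd_l R ιX K' constEmb constEmb_injective hinvc hinvp).BN) =
      ((m.symm (φΛ x) : (ofConnectedTemperoidData h (RD.levelStub ιX) odd_l R ιX K' constEmb constEmb_injective hinvc hinvp).muTorsion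
          (ofConnectedTemperoidData h (RD.levelStub ιX) odd_l R ιX K' constEmb constEmb_injective hinvc hinvp).BN
          (ofConnectedTemperoidData h (RD.levelStub ιX) odd_l R ιX K' constEmb constEmb_injective hinvc hinvp).N) :
        Aut (ofConnectedTemperoidData h (RD.levelStub ιX) odd_l R ιX K' constEmb constEmb_injective hinvc hinvp).BN) := by
  have hcov := lDeltaCovered_levelStub_of_pins.{u₀, v₀, w'} h odd_l R ιX K' constEmb constEmb_injective hinvc hinvp P hPpre hPproj_pin
  have hlift := hlift_levelStub_of_pin.{u₀, v₀, w'} h odd_l R ιX K' constEmb constEmb_injective hinvc hinvp P hPpre hH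
  have hγ := RD.symm_apply_apply_mem_PiYdd_of_cor218i ιX h218i φ
  have hγL := RD.thetaMod_transport_of_cor218i ιX h218i φ φQ φΛ hq hιN
  have hγΔ := gammaDelta_eta_of_lift HF RD (MulEquiv.refl _) m hι hη hpin hlift θ' (fun x => ιX.symm (φ (ιX x))) hγ
    hshadow φΛ hγL
  exact psiAut_symm_eq_of_rigidity HF RD.toThetaEnvData (MulEquiv.refl _) m hι hpin hKD hcov Ψ β aΨ θ' hΔ hK4β
    (fun x => ιX.symm (φ (ιX x))) hγ hshadow φΛ hγΔ x

end LevelN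

end ThetaFrobenioid

end Literature.AnabelianGeometry.EtaleTheta

end
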